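import Mathlib
import Literature.Analysis.FluidPDE.NSVorticityBKMHolds
import Literature.Analysis.FluidPDE.ConstantinFeffermanHolds
import Summits.NavierStokesRegularity.NavierStokesRegularity.Theses.PlaneEnergyCeiling
import Summits.NavierStokesRegularity.NavierStokesRegularity.Theorems.PlaneEnergyCeilingPlanarEnergyAPrioriClosedSlab
import Summits.NavierStokesRegularity.NavierStokesRegularity.Theorems.CertifiedBlowupCertifiedBlowupAxisymBlowupBKM

/-!
# Route PlaneEnergyCeiling · crux `PlanarEnergyAPriori` — the vorticity corners (BKM, Constantin–Fefferman)

Helper file for the crux item stmt-NavierStokesRegularity-16855 (`PlanarEnergyAPriori`, route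
`PlaneEnergyCeiling`), landed `--supports` that item. Two more discharged continuation classes in
which the crux HOLDS, completing the corner catalogue (axisymmetric, Type I, ESS `L³`, bounded,
every LPS class, critical Besov, small data):

* `planarCeiling_of_bkm` — the Beale–Kato–Majda class `∫₀ᵀ ‖curl u(t)‖_{L^∞} dt < ∞`
  (`beale_kato_majda_holds`): the solution continues in the Sobolev class past `T`, hence
  (`planarCeiling_of_hasSmoothExtensionPast`) its planar energies are bounded on `[0,T)`;
* `planarCeiling_of_vorticityDirection` — the Constantin–Fefferman class (Lipschitz coherence of
  the vorticity direction where `|ω| > Ω`; `constantin_fefferman_holds`): same conclusion;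
* the regularity hypothesis of both criteria (bounded Sobolev norms on every closed sub-slab
  `[0,T'']`, `T'' < T`) is the landed `hasBoundedSobolevNormsOn_before_of_lerayHopf_classical`
  (route CertifiedBlowup; Tao-class development of the datum).

Registered closed forms `planarCeiling_of_bkm_closedForm`, `planarCeiling_of_vorticityDirection_closedForm`.
Folklore assembly of in-tree facts.
-/

noncomputable section

-- single-conjunct summit: `Summit.<Summit>.<Problem>` repeats the name by the D-0017 layout
set_option linter.dupNamespace false

namespace Summit.NavierStokesRegularity.NavierStokesRegularity.Theorems.PlanarEnergyAPriori

open MeasureTheory Set Filter Topology WithLp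
open scoped ENNReal NNReal RealInnerProductSpace
open Literature.Analysis.FluidPDE
open Summit.NavierStokesRegularity.NavierStokesRegularity.Theorems.CertifiedBlowupAxisymBlowup.CompactAmplification
  (hasBoundedSobolevNormsOn_before_of_lerayHopf_classical)

variable {ν T : ℝ} {u : ℝ → EuclideanSpace ℝ (Fin 3) → EuclideanSpace ℝ (Fin 3)}
  {p : ℝ → EuclideanSpace ℝ (Fin 3) → ℝ}

/-- **The Beale–Kato–Majda corner.** If a classical solution on `[0,T)`, Leray–Hopf from its
rapidly decaying datum, has `∫₀ᵀ ‖curl u(t)‖_{L^∞} dt < ∞`, then its planar energies are bounded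
on `[0,T)`, uniformly in `t`, `R`, `c`: BKM continuation past `T` (`beale_kato_majda_holds`) and
`planarCeiling_of_hasSmoothExtensionPast`. [cite: BealeKatoMajda1984, Theorem 1 and Corollary] -/
theorem planarCeiling_of_bkm (hν : 0 < ν) (hT : 0 < T)
    (hcl : IsClassicalNSSolutionOn (Ico 0 T) ν 0 u p) (hLH : IsLerayHopfOn T ν 0 (u 0) u)
    (hdec : HasRapidSpatialDecay (u 0))
    (hω : (∫⁻ t in Ioo 0 T, ⨆ x, ‖curl (u t) x‖ₑ) < ∞) :
    ∃ M : ℝ, ∀ t ∈ Ico 0 T, ∀ (R : EuclideanSpace ℝ (Fin 3) ≃ₗᵢ[ℝ] EuclideanSpace ℝ (Fin 3)) (c : ℝ),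
      ∫⁻ y : EuclideanSpace ℝ (Fin 2), ‖u t (R (toLp 2 ![y 0, y 1, c]))‖ₑ ^ 2 ≤ ENNReal.ofReal M :=
  planarCeiling_of_hasSmoothExtensionPast hν hT hcl hLH hdec
    ((beale_kato_majda_holds hν.le hT hcl (hasBoundedSobolevNormsOn_before_of_lerayHopf_classical hν hT hcl hLH hdec)).2
      hω).hasSmoothExtensionPast

/-- **The Constantin–Fefferman corner.** If a classical solution on `[0,T)`, Leray–Hopf from its
rapidly decaying datum, has a Lipschitz-coherent vorticity direction in the region of high
vorticity (`|sin ∠(ξ(x,t), ξ(y,t))| ≤ |x − y|/ρ` whenever `|ω(x,t)|, |ω(y,t)| > Ω`), then its planar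
energies are bounded on `[0,T)`: Constantin–Fefferman continuation (`constantin_fefferman_holds`)
and `planarCeiling_of_hasSmoothExtensionPast`. [cite: ConstantinFeffermanIndiana1993, Theorem (§1)] -/
theorem planarCeiling_of_vorticityDirection (hν : 0 < ν) (hT : 0 < T)
    (hcl : IsClassicalNSSolutionOn (Ico 0 T) ν 0 u p) (hLH : IsLerayHopfOn T ν 0 (u 0) u)
    (hdec : HasRapidSpatialDecay (u 0)) {Ω ρ : ℝ} (hΩ : 0 < Ω) (hρ : 0 < ρ)
    (hdir : ∀ t ∈ Ico 0 T, ∀ x y : EuclideanSpace ℝ (Fin 3), Ω < ‖curl (u t) x‖ → Ω < ‖curl (u t) y‖ →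
      Real.sqrt (1 - ⟪vorticityDirection (curl (u t)) x, vorticityDirection (curl (u t)) y⟫ ^ 2) ≤
        ‖x - y‖ / ρ) :
    ∃ M : ℝ, ∀ t ∈ Ico 0 T, ∀ (R : EuclideanSpace ℝ (Fin 3) ≃ₗᵢ[ℝ] EuclideanSpace ℝ (Fin 3)) (c : ℝ),
      ∫⁻ y : EuclideanSpace ℝ (Fin 2), ‖u t (R (toLp 2 ![y 0, y 1, c]))‖ₑ ^ 2 ≤ ENNReal.ofReal M :=
  planarCeiling_of_hasSmoothExtensionPast hν hT hcl hLH hdec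
    (constantin_fefferman_holds hν hT hΩ hρ hcl (hasBoundedSobolevNormsOn_before_of_lerayHopf_classical hν hT hcl hLH hdec)
      hdir).hasSmoothExtensionPast

/-- **`planarCeiling_of_bkm_closedForm`, registered form** (sub-goal of
stmt-NavierStokesRegularity-16855): the crux HOLDS in the Beale–Kato–Majda class
`∫₀ᵀ ‖curl u‖_{L^∞} < ∞`. [cite: BealeKatoMajda1984, Theorem 1 and Corollary] -/
theorem planarCeiling_of_bkm_closedForm : ∀ (ν T : ℝ), 0 < ν → 0 < T → ∀ (u : ℝ → EuclideanSpace ℝ (Fin 3) → EuclideanSpace ℝ (Fin 3)) (p : ℝ → EuclideanSpace ℝ (Fin 3) → ℝ), Literature.Analysis.FluidPDE.IsClassicalNSSolutionOn (Set.Ico 0 T) ν 0 u p → Literature.Analysis.FluidPDE.IsLerayHopfOn T ν 0 (u 0) u → Literature.Analysis.FluidPDE.HasRapidSpatialDecay (u 0) → (∫⁻ t in Set.Ioo 0 T, ⨆ x, ‖Literature.Analysis.FluidPDE.curl (u t) x‖ₑ) < ⊤ → ∃ M : ℝ, ∀ t ∈ Set.Ico 0 T, ∀ (R : EuclideanSpace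 ℝ (Fin 3) ≃ₗᵢ[ℝ] EuclideanSpace ℝ (Fin 3)) (c : ℝ), ∫⁻ y : EuclideanSpace ℝ (Fin 2), ‖u t (R (WithLp.toLp 2 ![y 0, y 1, c]))‖ₑ ^ 2 ≤ ENNReal.ofReal M :=
  fun _ _ hν hT _ _ hcl hLH hdec hω => planarCeiling_of_bkm hν hT hcl hLH hdec hω

/-- **`planarCeiling_of_vorticityDirection_closedForm`, registered form** (sub-goal of
stmt-NavierStokesRegularity-16855): the crux HOLDS in the Constantin–Fefferman class.
[cite: ConstantinFeffermanIndiana1993, Theorem (§1)] -/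
theorem planarCeiling_of_vorticityDirection_closedForm : ∀ (ν T : ℝ), 0 < ν → 0 < T → ∀ (u : ℝ → EuclideanSpace ℝ (Fin 3) → EuclideanSpace ℝ (Fin 3)) (p : ℝ → EuclideanSpace ℝ (Fin 3) → ℝ), Literature.Analysis.FluidPDE.IsClassicalNSSolutionOn (Set.Ico 0 T) ν 0 u p → Literature.Analysis.FluidPDE.IsLerayHopfOn T ν 0 (u 0) u → Literature.Analysis.FluidPDE.HasRapidSpatialDecay (u 0) → ∀ (Ω ρ : ℝ), 0 < Ω → 0 < ρ → (∀ t ∈ Set.Ico 0 T, ∀ x y : EuclideanSpace ℝ (Fin 3), Ω < ‖Literature.Analysis.FluidPDE.curl (u t) x‖ → Ω < ‖Literature.Analysis.FluidPDE.curl (u t) y‖ → Real.sqrt (1 - inner ℝ (Literature.Analysis.FluidPDE.vorticityDirection (Literature.Analysis.FluidPDE.curl (u t)) x) (Literature.Analysis.FluidPDE.vorticityDirection (Literature.Analysis.FluidPDE.curl (u t)) y) ^ 2) ≤ ‖x - y‖ / ρ) → ∃ M : ℝ, ∀ t ∈ Set.Ico 0 T, ∀ (R : EuclideanSpace ℝ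 (Fin 3) ≃ₗᵢ[ℝ] EuclideanSpace ℝ (Fin 3)) (c : ℝ), ∫⁻ y : EuclideanSpace ℝ (Fin 2), ‖u t (R (WithLp.toLp 2 ![y 0, y 1, c]))‖ₑ ^ 2 ≤ ENNReal.ofReal M :=
  fun _ _ hν hT _ _ hcl hLH hdec _ _ hΩ hρ hdir => planarCeiling_of_vorticityDirection hν hT hcl hLH hdec hΩ hρ hdir

end Summit.NavierStokesRegularity.NavierStokesRegularity.Theorems.PlanarEnergyAPriori

end
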